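import Literature.MathematicalPhysics.QuantumFieldTheory.Balaban1983to89.Node00.Record12BgRowCubeGeometry

/-!
# NODE 00 — ROW P11: THE COMB-GAUGE GRADIENT LEMMA — the derivative member `|∇^ξ A| < …` of (1.12) [I] ∕ (2.38) [III] for the axial potential of record,
# from the plaquette class bound AND ONE covariant C¹ class bound on adjacent plaquettes (the gauge-free reading of [15] Thm 1 (9)–(10))

Cell `pub-ymgap`, seat `pub-ymgap-node00-def-P11` g2 (R218 ∕ OPS-NOTE-16; INTENT-7 INBOX l.16599; g0 HANDOFF (t4) «the C¹ comb-gauge lemma»).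
[I] = [Balaban1987RG1]; [III] = [Balaban1988Convergent]; [15] = [Balaban1985Variational]; pv26 = `T4AxialGaugeSmallField` (the torus non-abelian
Poincaré lemma: corner axial gauge, tree bonds `= 1`, `dist1 (U^{ax}(x, x+e_μ)) ≤ (Σ_{κ<μ}|x_κ − lo_κ|)·a`).

HONEST FRAMING.  Kernel lattice-gauge algebra (group identities on `ℤ^d` words + operator-norm inequalities in `M_N(ℂ)`) around ONE MORE DISPLAYED
CLASS HYPOTHESIS with its locator (`PlaqC1SmallOn`, below); nothing of Bałaban is asserted or discharged; K0‴ NOT closed; counts unmoved (typed 28∕28 ·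
discharged 5∕28); one finite `𝕋⁴` torus family at fixed `ε = L^{−K}`; not continuum ∕ OS ∕ mass gap ∕ Clay.  Two `def`s (the C¹ hypothesis on a box of
`ℤ^d` and on a set of torus plaquettes), no `instance`, no `sorry`.

WHAT IT IS FOR.  def-P11 FILES 4∕5 (`Record12BgRowGaugeAxial`, `Record12BgRowCubeGeometry`) supply clauses (a)(b) of the small local gauges (1.12)∕(2.38)
(`U^u = exp iξA`, `|A| < …`) on the cubes of record by the AXIAL GAUGE from the plaquette class bound `|∂U − 1| < b·η_j²` ([15] Thm 1 (8)), and
DISPLAY clause (c) — the derivative member `|∇^ξ A| < O(1)LMB·α₀` — as the hypotheses `h3I`∕`h3MS` of ★★★ `bgRowAt_of_thm1ScaledSep` (FILE 5 v1.2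
:658; = node00-def-K0a 11b `bgSep_of_thm1ScaledSep (h3I) (h3MS)`): a statement about the gradient of the axial potential, which the class bound (8)
alone does NOT give (translating a bond across the comb changes a product of `O(LM·L^j)` plaquettes).  THIS FILE proves that ONE further gauge-INVARIANT
class datum — a covariant C¹ bound on ADJACENT plaquettes, `dist1 (U(b)·U(∂(p + e_ν))·U(b)⁻¹·U(∂p)⁻¹) < b′·η_j³` — gives the derivative member
for the axial potential with a SCALE-FREE constant, so that `h3I`∕`h3MS` follow from a class hypothesis in the same currency as (8).  The C¹ datum is the
located gauge-free reading of [15] Thm 1 (9)–(10) p. 279 (there, on every cube `□` of the class of p. 278–279 — size `2ML^jη`, `M ≤ M(ε₁) = R₁M₁a₁∕ε₁`,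
concentric `(2M + 4R₁M₁)L^jη`-cube inside `Ω_j ∖ Ω_{j+2}` and not inside `Ω_{j+1} ∖ Ω_{j+2}` — a gauge `u` with `U^u = e^{iηA}`, `|A| < B₃Mε₁(L^jη)⁻¹`,
`|∇^ηA| < B₃Mε₁(L^jη)⁻²` (9), `|∂^{η*}∂^ηA|, |Δ^ηA| < B₃Mε₁(L^jη)⁻³` (10); a covariant derivative of the curvature is `O(ε₁(L^jη)⁻³)` there);
it is DISPLAYED by consumers, never asserted here.

THE LEMMA (§2–§3).  Box `[lo, hi] ⊂ ℤ^d` with `n + 1` sites per direction, corner axial gauge `W = V^{axialFn V lo}` (pv26∕b08: `W(x, x+e_μ) = 1` iff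
`x_κ = lo_κ` for all `κ < μ`).  Hypotheses: `dist1 (V(∂p)) ≤ a` on box plaquettes (`BoxPlaqSmall`), the C¹ datum `≤ a′` on adjacent box plaquettes
(`BoxPlaqC1Small`, gauge invariant).  (R) STAIRCASE STEP: for `κ < μ` and `y` with its coordinates below `κ` at the corner, the plaquette identity and the two
tree bonds give `W(y + e_κ, μ) = W(∂p_{κμ}(y))·W(y, μ)` exactly (`axial_step`).  (D1) in the gauge `W`, adjacent plaquette variables differ by
`≤ a′ + 2a·A` where `A = (d−1)n·a` bounds the bonds (`norm_hol_shift_sub_hol_le`: covariant difference + commutator `‖[X,Y]‖ ≤ 2‖X−1‖‖Y−1‖`).  (D4) TRANSLATE: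
for `ν ≥ μ` the staircase of `⟨x + e_ν, μ⟩` is the translate of that of `⟨x, μ⟩`, so by downward induction on the level (coordinates below `k` at the corner)
and induction on the `k`-th coordinate, `‖W(x + e_ν, μ) − W(x, μ)‖ ≤ (d−1)n·(a′ + 2a·A)` (`norm_axial_translate_sub_le`).  (D6) for `ν < μ` the plaquette at
`x` in the plane `(ν, μ)` gives `W(x + e_ν, μ) = W(x,ν)⁻¹·W(∂p)·W(x,μ)·W(x + e_μ, ν)`, whence `‖W(x + e_ν, μ) − W(x, μ)‖ ≤ a + (d−1)n(a′ + 2aA) + 2A²`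
for ALL `μ, ν` (`norm_axial_shift_sub_le`).  §3 transports to the torus (pv26 `castSite`∕`pull`∕`axialGauge`) and through the 4-Lipschitz logarithmic chart
(§1b): ★ `norm_grad_axialPotential_le` — `‖∇^ξ_ν A_μ(x)‖ ≤ 4(a + (d−1)n(a′ + 2aA) + 2A²)∕ξ²`; at `a = bξ²`, `a′ = b′ξ³`, `nξ ≤ LM` this is
`≤ 4(b + (d−1)LM·b′ + 4(d−1)²L²M²·b²)` — scale-free.  The record-level suppliers of `h3I`∕`h3MS` (cube geometry + letters) are the sequel file
`Record12BgRowGaugeC1`.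

CONTENTS.  §1 `M_N(ℂ)` algebra: `norm_mul_sub_mul_le`, `norm_comm_sub_le`, `norm_coe_su`, `dist1_su_eq`, `coe_inv_su`∕`coe_inv_mul_coe_su`∕`coe_mul_coe_inv_su`,
`norm_mul_coe_su`∕`norm_coe_su_mul`, `norm_coe_sub_coe_eq_dist1`, `norm_conj_sub_eq_dist1`, `norm_sub_le_covariant`, `norm_sub_le_of_plaq_identity`.  §1b
`norm_pow_sub_pow_le_half`, ★ `norm_logOnePlus_sub_logOnePlus_le` (4-Lipschitz on the ½-ball).  §2 `BoxPlaqC1Small` (def), `boxPlaqC1Small_gaugeAct`,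
`boxPlaqSmall_gaugeAct`, `e_apply_nonneg`, `le_add_e`, `lowPart_sub_eq_zero_of`, `lowPart_add_e_sub_eq_zero_of`, `norm_hol_shift_sub_hol_le` (D1), `axial_step` (R),
`norm_axial_translate_sub_le_aux`∕`norm_axial_translate_sub_le` (D4), ★ `norm_axial_shift_sub_le` (D6).  §3 `PlaqC1SmallOn` (def) + `.of_le`∕`.mono`,
`boxPlaqC1Small_pull`, ★★ `norm_grad_axialPotential_le`.

DEPENDENCES (by name): pv26 `T4AxialGaugeSmallField.(BoxPlaqSmall, castSite, castSite_add_e, pull, axialGauge, boxPlaqs, boxPlaqSmall_pull, gaugeAct_axialGauge_castSite,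
hol_pull_plaqWord_of_lt, dist1_axial_bond_le_uniform)`; b07∕b08 `B7Prop1Explicit.(hol, gaugeAct, axialFn, plaqWord, e, hol_gaugeAct_closed, disp_plaqWord)`,
`B7Prop1Local.hol_plaqWord_eq`, `B8Lemma1NonAbelian.(lowPart, axial_treeBond_eq_one, e_nonneg)`; def-P11 FILE 4 `axialPotential`; `Literature.Analysis.Complex.logOnePlus`
(`hasSum_logOnePlus`, `norm_logSeriesCoeff_le`); Mathlib `CStarRing.norm_mul_mem_unitary`∕`norm_mem_unitary_mul`, `hasSum_coe_mul_geometric_of_norm_lt_one`;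
r11 `B12RegularSpaces111.grad`; `Record11.(MatA, ιSU, coe_ιSU)`; `UnitaryModel.norm_of_mem_unitaryGroup`.
-/

noncomputable section

open scoped Matrix.Norms.L2Operator

namespace Literature.MathematicalPhysics.QuantumFieldTheory.Balaban1983to89.Node00

open T4Continuum
open Literature.Analysis.Complex (logOnePlus logSeriesCoeff summable_logOnePlus hasSum_logOnePlus norm_logSeriesCoeff_le)
open B7Prop1Explicit (Letter e e_apply hol gaugeAct axialFn plaqWord disp_plaqWord hol_gaugeAct_closed)
open B8Lemma1NonAbelian (lowPart lowPart_apply axial_treeBond_eq_one)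
open B7Prop1Local (hol_plaqWord_eq)
open T4AxialGaugeSmallField (BoxPlaqSmall dist1_axial_bond_le_uniform)

/-! ## §1  Matrix algebra in `M_N(ℂ)` (operator norm): unitary products, the commutator bound, the Lipschitz bound of the logarithmic chart -/

section MatrixAlgebra

variable {N : ℕ}

/-- Products of norm-`≤ 1` elements: `‖X₁X₂ − Y₁Y₂‖ ≤ ‖X₁ − Y₁‖ + ‖X₂ − Y₂‖` (`‖X₁‖ ≤ 1`, `‖Y₂‖ ≤ 1`). [folklore] -/
private theorem norm_mul_sub_mul_le {X₁ X₂ Y₁ Y₂ : MatA N} (h1 : ‖X₁‖ ≤ 1) (h2 : ‖Y₂‖ ≤ 1) :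
    ‖X₁ * X₂ - Y₁ * Y₂‖ ≤ ‖X₁ - Y₁‖ + ‖X₂ - Y₂‖ := by
  have h : X₁ * X₂ - Y₁ * Y₂ = X₁ * (X₂ - Y₂) + (X₁ - Y₁) * Y₂ := by noncomm_ring
  rw [h]
  calc ‖X₁ * (X₂ - Y₂) + (X₁ - Y₁) * Y₂‖ ≤ ‖X₁ * (X₂ - Y₂)‖ + ‖(X₁ - Y₁) * Y₂‖ := norm_add_le _ _
    _ ≤ ‖X₁‖ * ‖X₂ - Y₂‖ + ‖X₁ - Y₁‖ * ‖Y₂‖ := add_le_add (norm_mul_le _ _) (norm_mul_le _ _)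
    _ ≤ 1 * ‖X₂ - Y₂‖ + ‖X₁ - Y₁‖ * 1 := by gcongr
    _ = ‖X₁ - Y₁‖ + ‖X₂ - Y₂‖ := by ring

/-- **The commutator bound**: `‖XY − YX‖ ≤ 2‖X − 1‖·‖Y − 1‖` (`XY − YX = (X−1)(Y−1) − (Y−1)(X−1)`). [folklore] -/
private theorem norm_comm_sub_le (X Y : MatA N) : ‖X * Y - Y * X‖ ≤ 2 * ‖X - 1‖ * ‖Y - 1‖ := by
  have h : X * Y - Y * X = (X - 1) * (Y - 1) - (Y - 1) * (X - 1) := by noncomm_ring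
  rw [h]
  calc ‖(X - 1) * (Y - 1) - (Y - 1) * (X - 1)‖ ≤ ‖(X - 1) * (Y - 1)‖ + ‖(Y - 1) * (X - 1)‖ := norm_sub_le _ _
    _ ≤ ‖X - 1‖ * ‖Y - 1‖ + ‖Y - 1‖ * ‖X - 1‖ := add_le_add (norm_mul_le _ _) (norm_mul_le _ _)
    _ = 2 * ‖X - 1‖ * ‖Y - 1‖ := by ring

/-- An `SU(N)` matrix has operator norm `1`. [folklore] -/
private theorem norm_coe_su [NeZero N] (g : SU N) : ‖((g : SU N) : MatA N)‖ = 1 :=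
  UnitaryModel.norm_of_mem_unitaryGroup (Matrix.specialUnitaryGroup_le_unitaryGroup g.prop)

/-- `dist1 g = ‖g − 1‖_{op}` for the cell's `SU(N)` instance (`rfl`). [folklore] -/
private theorem dist1_su_eq [NeZero N] (g : SU N) : dist1 g = ‖((g : SU N) : MatA N) - 1‖ := rfl

/-- `(g⁻¹ : SU N)` is the adjoint matrix (`rfl`). [folklore] -/
private theorem coe_inv_su (g : SU N) : ((g⁻¹ : SU N) : MatA N) = star (g : MatA N) := rfl

/-- `g⁻¹·g = 1` in matrices. [folklore] -/
private theorem coe_inv_mul_coe_su (g : SU N) : ((g⁻¹ : SU N) : MatA N) * (g : MatA N) = 1 := g.prop.1.1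

/-- `g·g⁻¹ = 1` in matrices. [folklore] -/
private theorem coe_mul_coe_inv_su (g : SU N) : (g : MatA N) * ((g⁻¹ : SU N) : MatA N) = 1 := g.prop.1.2

/-- Right multiplication by an `SU(N)` matrix preserves the operator norm. [folklore] -/
private theorem norm_mul_coe_su (X : MatA N) (g : SU N) : ‖X * (g : MatA N)‖ = ‖X‖ :=
  CStarRing.norm_mul_mem_unitary X (Matrix.specialUnitaryGroup_le_unitaryGroup g.prop)

/-- Left multiplication by an `SU(N)` matrix preserves the operator norm. [folklore] -/
private theorem norm_coe_su_mul [NeZero N] (g : SU N) (X : MatA N) : ‖(g : MatA N) * X‖ = ‖X‖ :=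
  CStarRing.norm_mem_unitary_mul X (Matrix.specialUnitaryGroup_le_unitaryGroup g.prop)

/-- `‖g − h‖ = dist1 (g·h⁻¹)` on `SU(N)`. [folklore] -/
private theorem norm_coe_sub_coe_eq_dist1 [NeZero N] (g h : SU N) : ‖(g : MatA N) - (h : MatA N)‖ = dist1 (g * h⁻¹) := by
  rw [dist1_su_eq]
  have : ((g * h⁻¹ : SU N) : MatA N) - 1 = ((g : MatA N) - (h : MatA N)) * ((h⁻¹ : SU N) : MatA N) := by
    rw [sub_mul, coe_mul_coe_inv_su, Submonoid.coe_mul]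
  rw [this, norm_mul_coe_su]

/-- `‖gXg⁻¹ − Y‖ = dist1 (g·X·g⁻¹·Y⁻¹)` on `SU(N)` (the covariant difference as a `dist1`). [folklore] -/
private theorem norm_conj_sub_eq_dist1 [NeZero N] (g X Y : SU N) :
    ‖(g : MatA N) * (X : MatA N) * ((g⁻¹ : SU N) : MatA N) - (Y : MatA N)‖ = dist1 (g * X * g⁻¹ * Y⁻¹) := by
  rw [← norm_coe_sub_coe_eq_dist1, Submonoid.coe_mul, Submonoid.coe_mul]

/-- **Adjacent group elements in a gauge differ by the covariant difference plus a commutator**: `‖X′ − X‖ ≤ dist1(g X′ g⁻¹ X⁻¹) + 2·dist1 X′·dist1 g`.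
[folklore] -/
private theorem norm_sub_le_covariant [NeZero N] (g X X' : SU N) :
    ‖(X' : MatA N) - (X : MatA N)‖ ≤ dist1 (g * X' * g⁻¹ * X⁻¹) + 2 * dist1 X' * dist1 g := by
  have h1 : ‖(X' : MatA N) - (g : MatA N) * (X' : MatA N) * ((g⁻¹ : SU N) : MatA N)‖ ≤ 2 * dist1 X' * dist1 g := by
    have hid : (X' : MatA N) - (g : MatA N) * (X' : MatA N) * ((g⁻¹ : SU N) : MatA N) =
        ((X' : MatA N) * (g : MatA N) - (g : MatA N) * (X' : MatA N)) * ((g⁻¹ : SU N) : MatA N) := by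
      rw [sub_mul, mul_assoc (X' : MatA N), coe_mul_coe_inv_su, mul_one]
    rw [hid, norm_mul_coe_su, dist1_su_eq, dist1_su_eq]
    exact norm_comm_sub_le _ _
  have h2 := norm_conj_sub_eq_dist1 g X' X
  calc ‖(X' : MatA N) - (X : MatA N)‖
      ≤ ‖(X' : MatA N) - (g : MatA N) * (X' : MatA N) * ((g⁻¹ : SU N) : MatA N)‖ +
          ‖(g : MatA N) * (X' : MatA N) * ((g⁻¹ : SU N) : MatA N) - (X : MatA N)‖ := norm_sub_le_norm_sub_add_norm_sub _ _ _
    _ ≤ 2 * dist1 X' * dist1 g + dist1 (g * X' * g⁻¹ * X⁻¹) := add_le_add h1 h2.le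
    _ = dist1 (g * X' * g⁻¹ * X⁻¹) + 2 * dist1 X' * dist1 g := add_comm _ _

/-- **The ν < μ step**: if `M′ = Q⁻¹·P·M·Q′` (the plaquette identity solved for the shifted bond) then
`‖M′ − M‖ ≤ dist1 P + ‖Q′ − Q‖ + 2·dist1 M·dist1 Q`. [folklore] -/
private theorem norm_sub_le_of_plaq_identity [NeZero N] (M M' Q Q' P : SU N) (h : M' = Q⁻¹ * P * M * Q') :
    ‖(M' : MatA N) - (M : MatA N)‖ ≤ dist1 P + ‖(Q' : MatA N) - (Q : MatA N)‖ + 2 * dist1 M * dist1 Q := by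
  subst h
  have hQM : ((Q⁻¹ : SU N) : MatA N) * ((Q : MatA N) * (M : MatA N)) = (M : MatA N) := by
    rw [← mul_assoc, coe_inv_mul_coe_su, one_mul]
  have e1 : ((Q⁻¹ * P * M * Q' : SU N) : MatA N) - (M : MatA N) =
      ((Q⁻¹ : SU N) : MatA N) * ((P : MatA N) * (M : MatA N) * (Q' : MatA N) - (Q : MatA N) * (M : MatA N)) := by
    rw [mul_sub, hQM]; simp only [Submonoid.coe_mul, mul_assoc]
  have e2 : (P : MatA N) * (M : MatA N) * (Q' : MatA N) - (Q : MatA N) * (M : MatA N) =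
      ((P : MatA N) - 1) * (M : MatA N) * (Q' : MatA N) + (M : MatA N) * ((Q' : MatA N) - (Q : MatA N)) +
        ((M : MatA N) * (Q : MatA N) - (Q : MatA N) * (M : MatA N)) := by noncomm_ring
  rw [e1, norm_coe_su_mul, e2]
  calc ‖((P : MatA N) - 1) * (M : MatA N) * (Q' : MatA N) + (M : MatA N) * ((Q' : MatA N) - (Q : MatA N)) +
          ((M : MatA N) * (Q : MatA N) - (Q : MatA N) * (M : MatA N))‖
      ≤ ‖((P : MatA N) - 1) * (M : MatA N) * (Q' : MatA N)‖ + ‖(M : MatA N) * ((Q' : MatA N) - (Q : MatA N))‖ +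
          ‖(M : MatA N) * (Q : MatA N) - (Q : MatA N) * (M : MatA N)‖ := norm_add₃_le
    _ ≤ dist1 P + ‖(Q' : MatA N) - (Q : MatA N)‖ + 2 * dist1 M * dist1 Q := by
        refine add_le_add (add_le_add ?_ ?_) ?_
        · rw [norm_mul_coe_su, norm_mul_coe_su, dist1_su_eq]
        · rw [norm_coe_su_mul]
        · rw [dist1_su_eq, dist1_su_eq]; exact norm_comm_sub_le _ _

end MatrixAlgebra

/-! ## §1b  The logarithmic chart is 4-Lipschitz on the ball `‖x‖ ≤ ½` -/

section Chart

variable {𝔸 : Type*} [NormedRing 𝔸] [NormedAlgebra ℂ 𝔸] [CompleteSpace 𝔸]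

omit [NormedAlgebra ℂ 𝔸] [CompleteSpace 𝔸] in
/-- `‖xⁿ − yⁿ‖ ≤ 2·n·(½)ⁿ·‖x − y‖` for `‖x‖, ‖y‖ ≤ ½` (non-commutative: `x^{n+1} − y^{n+1} = x(xⁿ − yⁿ) + (x − y)yⁿ`). [folklore] -/
private theorem norm_pow_sub_pow_le_half {x y : 𝔸} (hx : ‖x‖ ≤ 1 / 2) (hy : ‖y‖ ≤ 1 / 2) :
    ∀ n : ℕ, ‖x ^ n - y ^ n‖ ≤ 2 * ((n : ℝ) * (1 / 2 : ℝ) ^ n) * ‖x - y‖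
  | 0 => by simp
  | n + 1 => by
    rcases Nat.eq_zero_or_pos n with rfl | hn
    · simp only [zero_add, pow_one, Nat.cast_one, one_mul]; norm_num
    have ih := norm_pow_sub_pow_le_half hx hy n
    have hid : x ^ (n + 1) - y ^ (n + 1) = (x ^ n - y ^ n) * y + x ^ n * (x - y) := by rw [pow_succ, pow_succ]; noncomm_ring
    rw [hid]
    have hxn : ‖x ^ n‖ ≤ (1 / 2 : ℝ) ^ n := (norm_pow_le' x hn).trans (pow_le_pow_left₀ (norm_nonneg _) hx n)
    have hD := norm_nonneg (x - y)
    calc ‖(x ^ n - y ^ n) * y + x ^ n * (x - y)‖ ≤ ‖x ^ n - y ^ n‖ * ‖y‖ + ‖x ^ n‖ * ‖x - y‖ :=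
          (norm_add_le _ _).trans (add_le_add (norm_mul_le _ _) (norm_mul_le _ _))
      _ ≤ (2 * ((n : ℝ) * (1 / 2 : ℝ) ^ n) * ‖x - y‖) * (1 / 2) + (1 / 2 : ℝ) ^ n * ‖x - y‖ := by
          gcongr
      _ = 2 * (((n + 1 : ℕ) : ℝ) * (1 / 2 : ℝ) ^ (n + 1)) * ‖x - y‖ := by push_cast; ring

/-- **THE LOGARITHMIC CHART IS 4-LIPSCHITZ ON THE HALF-BALL**: `‖log(1 + x) − log(1 + y)‖ ≤ 4‖x − y‖` for `‖x‖, ‖y‖ ≤ ½`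
(termwise `|c_n|·‖xⁿ − yⁿ‖ ≤ 2n(½)ⁿ‖x − y‖`, `Σ n(½)ⁿ = 2`). [folklore] -/
private theorem norm_logOnePlus_sub_logOnePlus_le {x y : 𝔸} (hx : ‖x‖ ≤ 1 / 2) (hy : ‖y‖ ≤ 1 / 2) :
    ‖logOnePlus x - logOnePlus y‖ ≤ 4 * ‖x - y‖ := by
  have hx1 : ‖x‖ < 1 := hx.trans_lt (by norm_num)
  have hy1 : ‖y‖ < 1 := hy.trans_lt (by norm_num)
  have hsum : HasSum (fun n : ℕ => logSeriesCoeff n • (x ^ n - y ^ n)) (logOnePlus x - logOnePlus y) := by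
    have := (hasSum_logOnePlus hx1).sub (hasSum_logOnePlus hy1)
    simpa only [smul_sub] using this
  have hgeom : HasSum (fun n : ℕ => 2 * ((n : ℝ) * (1 / 2 : ℝ) ^ n) * ‖x - y‖) (4 * ‖x - y‖) := by
    have h := hasSum_coe_mul_geometric_of_norm_lt_one (r := (1 / 2 : ℝ)) (by norm_num)
    have h' := (h.mul_left 2).mul_right ‖x - y‖
    rwa [show (2 : ℝ) * (1 / 2 / (1 - 1 / 2) ^ 2) * ‖x - y‖ = 4 * ‖x - y‖ by norm_num] at h'
  refine hsum.norm_le_of_bounded hgeom fun n => ?_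
  calc ‖logSeriesCoeff n • (x ^ n - y ^ n)‖ ≤ ‖logSeriesCoeff n‖ * ‖x ^ n - y ^ n‖ := norm_smul_le _ _
    _ ≤ 1 * (2 * ((n : ℝ) * (1 / 2 : ℝ) ^ n) * ‖x - y‖) :=
        mul_le_mul (norm_logSeriesCoeff_le n) (norm_pow_sub_pow_le_half hx hy n) (norm_nonneg _) zero_le_one
    _ = 2 * ((n : ℝ) * (1 / 2 : ℝ) ^ n) * ‖x - y‖ := one_mul _

end Chart

/-! ## §2  `ℤ^d` level: the covariant C¹ box hypothesis, the axial-gauge staircase, the translate bound, the shifted-bond bound -/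

section Lattice

open T4AxialGaugeSmallField (BoxPlaqSmall dist1_axial_bond_le_uniform)

variable {d : ℕ}

/-- **THE COVARIANT C¹ BOX HYPOTHESIS** (gauge-INVARIANT; the located class-bound reading of [15] Thm 1 (9)–(10)): for every positively oriented unit
plaquette `p = (z; κ < μ)` and every direction `ν` with `p` and its translate `p + e_ν` in the order interval `[lo, hi] ⊂ ℤ^d`, the plaquette
holonomy at `z + e_ν`, transported back along the bond `⟨z, z + e_ν⟩`, differs from the one at `z` by at most `a′` in `dist1`:
`dist1 (V(z,ν)·V(∂(p + e_ν))·V(z,ν)⁻¹·V(∂p)⁻¹) ≤ a′`. [cite: Balaban1985Variational, Thm 1 (9)–(10) p.279] -/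
def BoxPlaqC1Small {G : Type*} [GaugeGroup G] (V : (Fin d → ℤ) → Fin d → G) (lo hi : Fin d → ℤ) (a' : ℝ) : Prop :=
  ∀ (z : Fin d → ℤ) (κ μ ν : Fin d), κ < μ → lo ≤ z → z + e κ + e μ + e ν ≤ hi →
    dist1 (V z ν * hol V (z + e ν) (plaqWord κ μ) * (V z ν)⁻¹ * (hol V z (plaqWord κ μ))⁻¹) ≤ a'

/-- The C¹ box hypothesis is GAUGE INVARIANT (the quantity is conjugated by `u(z)`). [cite: Balaban1985Variational, Thm 1 (9)–(10) p.279 (bookkeeping); Balaban1985Averaging, (12) p.19] -/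
theorem boxPlaqC1Small_gaugeAct {G : Type*} [GaugeGroup G] {V : (Fin d → ℤ) → Fin d → G} {lo hi : Fin d → ℤ} {a' : ℝ}
    (h : BoxPlaqC1Small V lo hi a') (u : (Fin d → ℤ) → G) : BoxPlaqC1Small (gaugeAct u V) lo hi a' := by
  intro z κ μ ν hκμ hz hz'
  have h1 := hol_gaugeAct_closed u V (z + e ν) (plaqWord κ μ) (disp_plaqWord κ μ)
  have h2 := hol_gaugeAct_closed u V z (plaqWord κ μ) (disp_plaqWord κ μ)
  rw [h1, h2]
  have hid : gaugeAct u V z ν * (u (z + e ν) * hol V (z + e ν) (plaqWord κ μ) * (u (z + e ν))⁻¹) * (gaugeAct u V z ν)⁻¹ *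
      (u z * hol V z (plaqWord κ μ) * (u z)⁻¹)⁻¹ =
      u z * (V z ν * hol V (z + e ν) (plaqWord κ μ) * (V z ν)⁻¹ * (hol V z (plaqWord κ μ))⁻¹) * (u z)⁻¹ := by
    unfold B7Prop1Explicit.gaugeAct; group
  rw [hid, GaugeGroup.dist1_conj]
  exact h z κ μ ν hκμ hz hz'

variable {N : ℕ} [NeZero N]

/-- **(D1) ADJACENT PLAQUETTE HOLONOMIES IN A GAUGE WITH SMALL BONDS**: if the box plaquettes are `≤ a` (`0 ≤ a`), the C¹ hypothesis holds with
`a′`, and the bond `W(z, ν)` has `dist1 ≤ A`, then `‖W(∂(p + e_ν)) − W(∂p)‖ ≤ a′ + 2·a·A` for `p = (z; κ < μ)` (matrix norm;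
`norm_sub_le_covariant`). [cite: Balaban1985Variational, Thm 1 (9)–(10) p.279 (bookkeeping); Balaban1987RG1, (1.12) p.262] -/
theorem norm_hol_shift_sub_hol_le {W : (Fin d → ℤ) → Fin d → SU N} {lo hi : Fin d → ℤ} {a a' A : ℝ}
    (hP : BoxPlaqSmall W lo hi a) (hC : BoxPlaqC1Small W lo hi a') (ha : 0 ≤ a) {z : Fin d → ℤ} {κ μ ν : Fin d}
    (hκμ : κ < μ) (hz : lo ≤ z) (hz' : z + e κ + e μ + e ν ≤ hi) (hA : dist1 (W z ν) ≤ A) :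
    ‖((hol W (z + e ν) (plaqWord κ μ) : SU N) : MatA N) - ((hol W z (plaqWord κ μ) : SU N) : MatA N)‖ ≤ a' + 2 * a * A := by
  have h1 := norm_sub_le_covariant (W z ν) (hol W z (plaqWord κ μ)) (hol W (z + e ν) (plaqWord κ μ))
  have hcov := hC z κ μ ν hκμ hz hz'
  have hX' : dist1 (hol W (z + e ν) (plaqWord κ μ)) ≤ a :=
    hP (z + e ν) κ μ (ne_of_lt hκμ) (hz.trans (le_add_of_nonneg_right (B8Lemma1NonAbelian.e_nonneg ν)))
      (by calc z + e ν + e κ + e μ = z + e κ + e μ + e ν := by abel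
            _ ≤ hi := hz')
  have hA0 : 0 ≤ A := (GaugeGroup.dist1_nonneg _).trans hA
  calc _ ≤ dist1 (W z ν * hol W (z + e ν) (plaqWord κ μ) * (W z ν)⁻¹ * (hol W z (plaqWord κ μ))⁻¹) +
        2 * dist1 (hol W (z + e ν) (plaqWord κ μ)) * dist1 (W z ν) := h1
    _ ≤ a' + 2 * a * A := by
        refine add_le_add hcov ?_
        have := mul_le_mul hX' hA (GaugeGroup.dist1_nonneg _) ha
        linarith

/-- **(R) THE AXIAL STAIRCASE STEP**: in the corner axial gauge `W = V^{axialFn V lo}`, for `κ < μ` and a base point `y` whose coordinates below `κ`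
sit at the corner (`lowPart κ (y − lo) = 0`), the bonds `⟨y, y+e_κ⟩`, `⟨y+e_μ, y+e_μ+e_κ⟩` are tree bonds, so the plaquette identity reads
`W(y + e_κ, μ) = W(∂p_{κμ}(y))·W(y, μ)`. [cite: Balaban1985Averaging, pp.24–25] -/
theorem axial_step {G : Type*} [Group G] (V : (Fin d → ℤ) → Fin d → G) (lo y : Fin d → ℤ) {κ μ : Fin d} (hκμ : κ < μ)
    (htree : lowPart κ (y - lo) = 0) :
    gaugeAct (axialFn V lo) V (y + e κ) μ = hol (gaugeAct (axialFn V lo) V) y (plaqWord κ μ) * gaugeAct (axialFn V lo) V y μ := by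
  set W := gaugeAct (axialFn V lo) V with hW
  have h1 : W y κ = 1 := axial_treeBond_eq_one V lo y κ htree
  have htree' : lowPart κ (y + e μ - lo) = 0 := by
    funext i
    have hi := congr_fun htree i
    simp only [lowPart_apply, Pi.sub_apply, Pi.zero_apply, Pi.add_apply] at hi ⊢
    by_cases hlt : i < κ
    · rw [if_pos hlt] at hi ⊢
      have : i ≠ μ := ne_of_lt (hlt.trans hκμ)
      rw [e_apply, if_neg this]; linarith
    · rw [if_neg hlt]
  have h2 : W (y + e μ) κ = 1 := axial_treeBond_eq_one V lo (y + e μ) κ htree'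
  have hp := hol_plaqWord_eq W y κ μ
  rw [h1, h2, one_mul, inv_one, mul_one] at hp
  rw [hp, inv_mul_cancel_right]

/-- The box plaquette hypothesis is gauge invariant (closed words are conjugated). [cite: Balaban1985Averaging, (12) p.19 (bookkeeping)] -/
theorem boxPlaqSmall_gaugeAct {G : Type*} [GaugeGroup G] {V : (Fin d → ℤ) → Fin d → G} {lo hi : Fin d → ℤ} {a : ℝ}
    (h : BoxPlaqSmall V lo hi a) (u : (Fin d → ℤ) → G) : BoxPlaqSmall (gaugeAct u V) lo hi a := by
  intro z κ μ hκμ hz hz'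
  rw [hol_gaugeAct_closed u V z (plaqWord κ μ) (disp_plaqWord κ μ), GaugeGroup.dist1_conj]
  exact h z κ μ hκμ hz hz'

/-- `0 ≤ (e μ) i` (lattice unit vectors). [cite: Balaban1985Averaging, (9) p.19 (bookkeeping)] -/
theorem e_apply_nonneg (μ i : Fin d) : (0 : ℤ) ≤ e μ i := by
  rw [e_apply]; split_ifs <;> norm_num

/-- `lo ≤ z` gives `lo ≤ z + e μ` (lattice unit vectors). [cite: Balaban1985Averaging, (9) p.19 (bookkeeping)] -/
theorem le_add_e {lo z : Fin d → ℤ} (h : lo ≤ z) (μ : Fin d) : lo ≤ z + e μ :=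
  h.trans (le_add_of_nonneg_right (B8Lemma1NonAbelian.e_nonneg μ))

/-- Coordinates below `κ` at the corner: `lowPart κ (y − lo) = 0` from `y i = lo i` for `i.val < κ.val`. [folklore] -/
private theorem lowPart_sub_eq_zero_of {κ : Fin d} {y lo : Fin d → ℤ} (h : ∀ i : Fin d, i.val < κ.val → y i = lo i) :
    lowPart κ (y - lo) = 0 := by
  funext i
  simp only [lowPart_apply, Pi.sub_apply, Pi.zero_apply]
  by_cases hlt : i < κ
  · rw [if_pos hlt, h i (Fin.lt_def.mp hlt), sub_self]
  · rw [if_neg hlt]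

/-- … and the same after a shift in a direction `ν ≥ κ`-above: `lowPart κ (y + e_ν − lo) = 0` for `κ ≤ ν`… precisely `κ < ν` or `κ ≤ ν`
with `ν ≠ i` for all `i < κ`. [folklore] -/
private theorem lowPart_add_e_sub_eq_zero_of {κ ν : Fin d} (hκν : κ ≤ ν) {y lo : Fin d → ℤ} (h : ∀ i : Fin d, i.val < κ.val → y i = lo i) :
    lowPart κ (y + e ν - lo) = 0 := by
  funext i
  simp only [lowPart_apply, Pi.sub_apply, Pi.zero_apply, Pi.add_apply]
  by_cases hlt : i < κ
  · have hne : i ≠ ν := ne_of_lt (lt_of_lt_of_le hlt hκν)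
    rw [if_pos hlt, h i (Fin.lt_def.mp hlt), e_apply, if_neg hne]; ring
  · rw [if_neg hlt]

/-- **(D4) THE TRANSLATE BOUND — staircase induction** (auxiliary form: the coordinates of `x` below level `k` already sit at the corner, `k + m = μ`):
translating a bond `⟨x, x + e_μ⟩` by `e_ν`, `ν ≥ μ`, changes its axial-gauge variable by at most `(m·n)·(a′ + 2a·A)`, `A = (d−1)·n·a`. [folklore] -/
private theorem norm_axial_translate_sub_le_aux (V : (Fin d → ℤ) → Fin d → SU N) {lo hi : Fin d → ℤ} {a a' : ℝ} {n : ℕ}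
    (hP : BoxPlaqSmall V lo hi a) (hC : BoxPlaqC1Small V lo hi a') (ha : 0 ≤ a) (ha' : 0 ≤ a') (hn : ∀ κ, hi κ ≤ lo κ + n)
    {μ ν : Fin d} (hμν : μ ≤ ν) :
    ∀ m k : ℕ, k + m = μ.val → ∀ x : Fin d → ℤ, lo ≤ x → x + e μ + e ν ≤ hi → (∀ i : Fin d, i.val < k → x i = lo i) →
      ‖((gaugeAct (axialFn V lo) V (x + e ν) μ : SU N) : MatA N) - ((gaugeAct (axialFn V lo) V x μ : SU N) : MatA N)‖ ≤
        ((m * n : ℕ) : ℝ) * (a' + 2 * a * ((((d - 1 : ℕ) : ℝ) * n * a))) := by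
  set W := gaugeAct (axialFn V lo) V with hW
  set c := a' + 2 * a * ((((d - 1 : ℕ) : ℝ) * n * a)) with hc
  have hc0 : 0 ≤ c := by positivity
  have hPW : BoxPlaqSmall W lo hi a := boxPlaqSmall_gaugeAct hP _
  have hCW : BoxPlaqC1Small W lo hi a' := boxPlaqC1Small_gaugeAct hC _
  intro m
  induction m with
  | zero =>
    intro k hk x hx hx' hlo
    have hk' : ∀ i : Fin d, i.val < μ.val → x i = lo i := fun i hi => hlo i (by omega)
    have h1 : W x μ = 1 := axial_treeBond_eq_one V lo x μ (lowPart_sub_eq_zero_of hk')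
    have h2 : W (x + e ν) μ = 1 := axial_treeBond_eq_one V lo (x + e ν) μ (lowPart_add_e_sub_eq_zero_of hμν hk')
    rw [h1, h2, sub_self, norm_zero]
    positivity
  | succ m ih =>
    intro k hk x hx hx' hlo
    have hkd : k < d := by have := μ.isLt; omega
    set κ : Fin d := ⟨k, hkd⟩ with hκ
    have hκμ : κ < μ := Fin.lt_def.mpr (by simp only [hκ]; omega)
    have hκν : κ < ν := lt_of_lt_of_le hκμ hμν
    -- inner induction on the distance `t` of the `κ`-coordinate from the corner
    have inner : ∀ t : ℕ, ∀ x : Fin d → ℤ, lo ≤ x → x + e μ + e ν ≤ hi → (∀ i : Fin d, i.val < k → x i = lo i) → x κ = lo κ + t →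
        ‖((W (x + e ν) μ : SU N) : MatA N) - ((W x μ : SU N) : MatA N)‖ ≤ ((t + m * n : ℕ) : ℝ) * c := by
      intro t
      induction t with
      | zero =>
        intro x hx hx' hlo hxκ
        have hlo' : ∀ i : Fin d, i.val < k + 1 → x i = lo i := by
          intro i hi
          rcases Nat.lt_or_ge i.val k with hlt | hge
          · exact hlo i hlt
          · have : i = κ := Fin.ext (by simp only [hκ]; omega)
            rw [this, hxκ]; simp
        have := ih (k + 1) (by omega) x hx hx' hlo'
        simpa using this
      | succ t iht =>
        intro x hx hx' hlo hxκ
        set y : Fin d → ℤ := x - e κ with hy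
        have hxy : x = y + e κ := by rw [hy, sub_add_cancel]
        have hylo : ∀ i : Fin d, i.val < k → y i = lo i := by
          intro i hi
          have hne : i ≠ κ := fun h => by rw [h] at hi; simp [hκ] at hi
          simp only [hy, Pi.sub_apply, e_apply, if_neg hne, sub_zero]
          exact hlo i hi
        have hyκ : y κ = lo κ + t := by
          have : y κ = x κ - 1 := by simp [hy, e_apply]
          rw [this, hxκ]; push_cast; ring
        have hly : lo ≤ y := by
          intro i
          by_cases hi : i = κ
          · rw [hi, hyκ]; linarith
          · have := hx i
            simp only [hy, Pi.sub_apply, e_apply, if_neg hi, sub_zero]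
            exact this
        have hyhi : y + e μ + e ν ≤ hi := by
          intro i
          have h1 := hx' i
          have h2 : y i ≤ x i := by rw [hxy]; simp only [Pi.add_apply]; linarith [e_apply_nonneg κ i]
          simp only [Pi.add_apply] at h1 ⊢
          linarith
        have hIH := iht y hly hyhi hylo hyκ
        -- the staircase step at `y` and at `y + e ν`
        have hstep : W x μ = hol W y (plaqWord κ μ) * W y μ := by
          rw [hxy]; exact axial_step V lo y hκμ (lowPart_sub_eq_zero_of hylo)
        have hstep' : W (x + e ν) μ = hol W (y + e ν) (plaqWord κ μ) * W (y + e ν) μ := by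
          rw [hxy, show y + e κ + e ν = y + e ν + e κ by abel]
          exact axial_step V lo (y + e ν) hκμ (lowPart_add_e_sub_eq_zero_of hκν.le hylo)
        have hyκhi : y + e κ + e μ + e ν ≤ hi := by rw [← hxy]; exact hx'
        have hA : dist1 (W y ν) ≤ ((d - 1 : ℕ) : ℝ) * n * a :=
          dist1_axial_bond_le_uniform V hP ha hn y ν hly fun i => by
            have h1 := hyκhi i
            simp only [Pi.add_apply] at h1 ⊢
            linarith [e_apply_nonneg κ i, e_apply_nonneg μ i]
        have hhol := norm_hol_shift_sub_hol_le hPW hCW ha hκμ hly hyκhi hA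
        rw [hstep, hstep', Submonoid.coe_mul, Submonoid.coe_mul]
        calc _ ≤ ‖((hol W (y + e ν) (plaqWord κ μ) : SU N) : MatA N) - ((hol W y (plaqWord κ μ) : SU N) : MatA N)‖ +
              ‖((W (y + e ν) μ : SU N) : MatA N) - ((W y μ : SU N) : MatA N)‖ :=
              norm_mul_sub_mul_le (norm_coe_su _).le (norm_coe_su _).le
          _ ≤ c + ((t + m * n : ℕ) : ℝ) * c := add_le_add hhol hIH
          _ = ((t + 1 + m * n : ℕ) : ℝ) * c := by push_cast; ring
    -- apply the inner claim at `t = x κ − lo κ ≤ n`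
    have hxκ0 : lo κ ≤ x κ := hx κ
    obtain ⟨t, ht⟩ : ∃ t : ℕ, x κ = lo κ + t := ⟨(x κ - lo κ).toNat, by rw [Int.toNat_of_nonneg (sub_nonneg.mpr hxκ0)]; ring⟩
    have htn : t ≤ n := by
      have h1 := hx' κ
      have h2 := hn κ
      simp only [Pi.add_apply] at h1
      have h3 := e_apply_nonneg μ κ
      have h4 := e_apply_nonneg ν κ
      have : (t : ℤ) ≤ n := by linarith
      exact_mod_cast this
    refine (inner t x hx hx' hlo ht).trans ?_
    have : ((t + m * n : ℕ) : ℝ) ≤ (((m + 1) * n : ℕ) : ℝ) := by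
      have : t + m * n ≤ (m + 1) * n := by nlinarith
      exact_mod_cast this
    exact mul_le_mul_of_nonneg_right this hc0

/-- **(D4) THE TRANSLATE BOUND**: in the corner axial gauge of a box with plaquettes `≤ a` and C¹ datum `≤ a′`, translating a box bond
`⟨x, x + e_μ⟩` by `e_ν` with `ν ≥ μ` (so the whole staircase translates) changes the gauge-fixed bond variable by at most
`(d − 1)·n·(a′ + 2a·A)`, `A = (d − 1)·n·a`. [cite: Balaban1987RG1, (1.12) p.262; Balaban1985Averaging, pp.24–25; Balaban1985Variational, Thm 1 (9)–(10) p.279] -/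
theorem norm_axial_translate_sub_le (V : (Fin d → ℤ) → Fin d → SU N) {lo hi : Fin d → ℤ} {a a' : ℝ} {n : ℕ}
    (hP : BoxPlaqSmall V lo hi a) (hC : BoxPlaqC1Small V lo hi a') (ha : 0 ≤ a) (ha' : 0 ≤ a') (hn : ∀ κ, hi κ ≤ lo κ + n)
    {μ ν : Fin d} (hμν : μ ≤ ν) {x : Fin d → ℤ} (hx : lo ≤ x) (hx' : x + e μ + e ν ≤ hi) :
    ‖((gaugeAct (axialFn V lo) V (x + e ν) μ : SU N) : MatA N) - ((gaugeAct (axialFn V lo) V x μ : SU N) : MatA N)‖ ≤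
      (((d - 1 : ℕ) : ℝ) * n) * (a' + 2 * a * ((((d - 1 : ℕ) : ℝ) * n * a))) := by
  have h := norm_axial_translate_sub_le_aux V hP hC ha ha' hn hμν μ.val 0 (by simp) x hx hx' (fun i hi => absurd hi (Nat.not_lt_zero _))
  refine h.trans (mul_le_mul_of_nonneg_right ?_ (by positivity))
  have : μ.val * n ≤ (d - 1) * n := Nat.mul_le_mul_right _ (by have := μ.isLt; omega)
  exact_mod_cast this

/-- **(D6) THE SHIFTED-BOND BOUND, ALL DIRECTIONS**: in the corner axial gauge of a box with plaquettes `≤ a` and C¹ datum `≤ a′` (box of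
`n + 1` sites per direction), for bonds `⟨x, x + e_μ⟩`, `⟨x + e_ν, x + e_ν + e_μ⟩` in the box (any `μ, ν`):
`‖W(x + e_ν, μ) − W(x, μ)‖ ≤ a + (d−1)n·(a′ + 2a·A) + 2A²`, `A = (d−1)n·a` — the case `ν < μ` by the plaquette identity
`W(x + e_ν, μ) = W(x,ν)⁻¹·W(∂p)·W(x,μ)·W(x + e_μ, ν)` and the commutator bound. [cite: Balaban1987RG1, (1.12) p.262; Balaban1985Averaging, pp.24–25; Balaban1985Variational, Thm 1 (9)–(10) p.279] -/
theorem norm_axial_shift_sub_le (V : (Fin d → ℤ) → Fin d → SU N) {lo hi : Fin d → ℤ} {a a' : ℝ} {n : ℕ}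
    (hP : BoxPlaqSmall V lo hi a) (hC : BoxPlaqC1Small V lo hi a') (ha : 0 ≤ a) (ha' : 0 ≤ a') (hn : ∀ κ, hi κ ≤ lo κ + n)
    (μ ν : Fin d) {x : Fin d → ℤ} (hx : lo ≤ x) (hx' : x + e μ + e ν ≤ hi) :
    ‖((gaugeAct (axialFn V lo) V (x + e ν) μ : SU N) : MatA N) - ((gaugeAct (axialFn V lo) V x μ : SU N) : MatA N)‖ ≤
      a + (((d - 1 : ℕ) : ℝ) * n) * (a' + 2 * a * ((((d - 1 : ℕ) : ℝ) * n * a))) + 2 * ((((d - 1 : ℕ) : ℝ) * n * a)) ^ 2 := by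
  set W := gaugeAct (axialFn V lo) V with hW
  set A := (((d - 1 : ℕ) : ℝ) * n * a) with hA
  set c := a' + 2 * a * A with hc
  have hA0 : 0 ≤ A := by positivity
  have hc0 : 0 ≤ c := by positivity
  rcases le_or_gt μ ν with hμν | hνμ
  · have h := norm_axial_translate_sub_le V hP hC ha ha' hn hμν hx hx'
    calc _ ≤ (((d - 1 : ℕ) : ℝ) * n) * c := h
      _ ≤ a + (((d - 1 : ℕ) : ℝ) * n) * c + 2 * A ^ 2 := by nlinarith
  · -- the plaquette at `x` in the plane `(ν, μ)`, `ν < μ`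
    have hPW : BoxPlaqSmall W lo hi a := boxPlaqSmall_gaugeAct hP _
    have hx'' : x + e ν + e μ ≤ hi := by rwa [add_right_comm] at hx'
    have hplaq := hol_plaqWord_eq W x ν μ
    set P := hol W x (plaqWord ν μ) with hPdef
    have hid : W (x + e ν) μ = (W x ν)⁻¹ * P * W x μ * W (x + e μ) ν := by rw [hplaq]; group
    have h1 := norm_sub_le_of_plaq_identity (W x μ) (W (x + e ν) μ) (W x ν) (W (x + e μ) ν) P hid
    have hPa : dist1 P ≤ a := hPW x ν μ (ne_of_lt hνμ) hx hx''
    have hQ : ‖((W (x + e μ) ν : SU N) : MatA N) - ((W x ν : SU N) : MatA N)‖ ≤ (((d - 1 : ℕ) : ℝ) * n) * c :=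
      norm_axial_translate_sub_le V hP hC ha ha' hn hνμ.le hx hx''
    have hM : dist1 (W x μ) ≤ A := dist1_axial_bond_le_uniform V hP ha hn x μ hx fun i => by
      have h1 := hx' i
      simp only [Pi.add_apply] at h1 ⊢
      linarith [e_apply_nonneg ν i]
    have hQ1 : dist1 (W x ν) ≤ A := dist1_axial_bond_le_uniform V hP ha hn x ν hx fun i => by
      have h1 := hx'' i
      simp only [Pi.add_apply] at h1 ⊢
      linarith [e_apply_nonneg μ i]
    calc _ ≤ dist1 P + ‖((W (x + e μ) ν : SU N) : MatA N) - ((W x ν : SU N) : MatA N)‖ + 2 * dist1 (W x μ) * dist1 (W x ν) := h1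
      _ ≤ a + (((d - 1 : ℕ) : ℝ) * n) * c + 2 * A ^ 2 := by
          refine add_le_add (add_le_add hPa hQ) ?_
          rw [sq]
          have := mul_le_mul hM hQ1 (GaugeGroup.dist1_nonneg _) hA0
          linarith

end Lattice

/-! ## §3  Torus level: the C¹ class hypothesis on torus plaquettes, its pullback to a box, the gradient bound for the axial potential of record -/

section Torus

open T4AxialGaugeSmallField (BoxPlaqSmall castSite castSite_add_e pull pull_apply axialGauge boxPlaqs boxBonds boxPlaqSmall_pull
  gaugeAct_axialGauge_castSite hol_pull_plaqWord_of_lt dist1_axial_bond_le_uniform)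
open Complex (I)
open B12RegularSpaces111 (grad)

variable {P : Params} {j : ℕ} {G : Type*} [GaugeGroup G]

/-- **THE COVARIANT C¹ CLASS HYPOTHESIS ON A SET OF TORUS PLAQUETTES** (gauge-INVARIANT; the `dist1` twin of `Setup.PlaqSmallOn` one derivative up):
for `p ∈ S` and every direction `ν` with the translate `p + e_ν ∈ S`, the plaquette variable at `p + e_ν` transported back along `⟨p.src, p.src + e_ν⟩`
differs from the one at `p` by `< δ`: `dist1 (U(b)·U(∂(p + e_ν))·U(b)⁻¹·U(∂p)⁻¹) < δ`.  The located class-bound reading of [15] Thm 1 (9)–(10)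
(«|∇^η A| < B₃Mε₁(L^jη)⁻²», «|∂*∂A|, |Δ^η A| < B₃Mε₁(L^jη)⁻³» in the gauge of (9) ⇒ covariant `∇F = O(ε₁(L^jη)⁻³)`), to be DISPLAYED with its
locator by consumers, never asserted. [cite: Balaban1985Variational, Thm 1 (9)–(10) p.279] -/
def PlaqC1SmallOn (S : Set (Plaq P j)) (δ : ℝ) (U : GaugeField P j G) : Prop :=
  ∀ p ∈ S, ∀ ν : Fin P.d, (⟨p.src.shift ν, p.μ, p.ν, p.hμν⟩ : Plaq P j) ∈ S →
    dist1 (U ⟨p.src, ν⟩ * GaugeField.plaqHol U ⟨p.src.shift ν, p.μ, p.ν, p.hμν⟩ * (U ⟨p.src, ν⟩)⁻¹ * (GaugeField.plaqHol U p)⁻¹) < δ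

/-- Weakening the bound. [cite: Balaban1985Variational, Thm 1 (9)–(10) p.279 (bookkeeping)] -/
theorem PlaqC1SmallOn.of_le {S : Set (Plaq P j)} {δ δ' : ℝ} {U : GaugeField P j G} (h : PlaqC1SmallOn S δ U) (hδ : δ ≤ δ') :
    PlaqC1SmallOn S δ' U := fun p hp ν hp' => (h p hp ν hp').trans_le hδ

/-- Shrinking the plaquette set. [cite: Balaban1985Variational, Thm 1 (9)–(10) p.279 (bookkeeping)] -/
theorem PlaqC1SmallOn.mono {S T : Set (Plaq P j)} {δ : ℝ} {U : GaugeField P j G} (h : PlaqC1SmallOn T δ U) (hST : S ⊆ T) :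
    PlaqC1SmallOn S δ U := fun p hp ν hp' => h p (hST hp) ν (hST hp')

/-- **THE C¹ CLASS HYPOTHESIS ON THE TORUS ⟹ THE C¹ BOX HYPOTHESIS FOR THE PULLBACK** (`S₀ ⊇ boxPlaqs lo hi`). [cite: Balaban1985Variational, Thm 1 (9)–(10) p.279 (bookkeeping)] -/
theorem boxPlaqC1Small_pull (U : GaugeField P j G) {lo hi : Fin P.d → ℤ} {δ : ℝ} {S₀ : Set (Plaq P j)}
    (hS₀ : boxPlaqs lo hi ⊆ S₀) (hU : PlaqC1SmallOn S₀ δ U) : BoxPlaqC1Small (pull U) lo hi δ := by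
  intro z κ μ ν hκμ hz hz'
  rw [hol_pull_plaqWord_of_lt U (z + e ν) hκμ, hol_pull_plaqWord_of_lt U z hκμ, pull_apply, castSite_add_e]
  have hzκμ : z + e κ + e μ ≤ hi := fun i => by
    have h1 := hz' i; simp only [Pi.add_apply] at h1 ⊢; linarith [e_apply_nonneg ν i]
  have hp : (⟨castSite z, κ, μ, hκμ⟩ : Plaq P j) ∈ S₀ := hS₀ ⟨z, hz, hzκμ, rfl⟩
  have hp' : (⟨(castSite z : Site P j).shift ν, κ, μ, hκμ⟩ : Plaq P j) ∈ S₀ := by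
    refine hS₀ ⟨z + e ν, le_add_e hz ν, fun i => ?_, (castSite_add_e z ν).symm⟩
    have h1 := hz' i; simp only [Pi.add_apply] at h1 ⊢; linarith
  exact (hU _ hp ν hp').le

variable {N : ℕ} [NeZero N]

/-- **★ THE COMB-GAUGE GRADIENT LEMMA ON THE TORUS**: for a non-wrapping box `[lo, hi]` (`n + 1` sites per direction, `n < sitesPerDir`) whose
plaquettes satisfy `dist1 (U(∂p)) < a` and the covariant C¹ bound `< a′` (`S₀ ⊇ boxPlaqs lo hi`), with the chart reachable (`(d−1)·n·a ≤ ½`), the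
axial potential of record `A = (iξ)⁻¹ log U^{u_ax}` (def-P11 FILE 4 `axialPotential`) has, at every pair of box bonds `⟨x, x+e_μ⟩`, `⟨x+e_ν, x+e_ν+e_μ⟩`,
`‖∇^ξ_ν A_μ (x)‖ ≤ 4·(a + (d−1)n·(a′ + 2a·A) + 2A²)∕ξ²`, `A = (d−1)n·a` — by §2 and the 4-Lipschitz logarithmic chart.
[cite: Balaban1987RG1, (1.12) p.262; Balaban1985Variational, Thm 1 (9)–(10) p.279] -/
theorem norm_grad_axialPotential_le (U : GaugeField P 0 (SU N)) {lo hi : Fin P.d → ℤ} {a a' : ℝ} {n : ℕ} {S₀ : Set (Plaq P 0)}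
    (hS₀ : boxPlaqs lo hi ⊆ S₀) (hU : PlaqSmallOn S₀ a U) (hC : PlaqC1SmallOn S₀ a' U) (ha : 0 ≤ a) (ha' : 0 ≤ a')
    (hn : ∀ κ, hi κ ≤ lo κ + n) (hnN : n < P.sitesPerDir 0) (hsmall : ((P.d - 1 : ℕ) : ℝ) * n * a ≤ 1 / 2) {ξ : ℝ} (hξ : 0 < ξ)
    (μ ν : Fin P.d) {z : Fin P.d → ℤ} (hz : lo ≤ z) (hz' : z + e μ + e ν ≤ hi) :
    ‖grad ξ ν (fun y => axialPotential U lo hi ξ ⟨y, μ⟩) (castSite z)‖ ≤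
      4 * (a + (((P.d - 1 : ℕ) : ℝ) * n) * (a' + 2 * a * ((((P.d - 1 : ℕ) : ℝ) * n * a))) + 2 * ((((P.d - 1 : ℕ) : ℝ) * n * a)) ^ 2) / ξ ^ 2 := by
  have hN' : ∀ κ, hi κ - lo κ < P.sitesPerDir 0 := fun κ => by
    have h1 := hn κ
    have h2 : (n : ℤ) < (P.sitesPerDir 0 : ℤ) := by exact_mod_cast hnN
    linarith
  have hzμ : z + e μ ≤ hi := fun i => by
    have h1 := hz' i; simp only [Pi.add_apply] at h1 ⊢; linarith [e_apply_nonneg ν i]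
  have hzν : lo ≤ z + e ν := le_add_e hz ν
  have hzνμ : z + e ν + e μ ≤ hi := by rwa [add_right_comm] at hz'
  -- the two bonds in the axial gauge are the `ℤ^d` gauge-fixed bond variables
  set W := gaugeAct (axialFn (pull U) lo) (pull U) with hW
  have hb : GaugeField.gaugeAct (axialGauge U lo hi) U ⟨castSite z, μ⟩ = W z μ := gaugeAct_axialGauge_castSite U hN' hz hzμ
  have hb' : GaugeField.gaugeAct (axialGauge U lo hi) U ⟨(castSite z : Site P 0).shift ν, μ⟩ = W (z + e ν) μ := by
    rw [← castSite_add_e]; exact gaugeAct_axialGauge_castSite U hN' hzν hzνμ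
  -- the box hypotheses for the pullback
  have hP : BoxPlaqSmall (pull U) lo hi a := boxPlaqSmall_pull U hS₀ hU
  have hC' : BoxPlaqC1Small (pull U) lo hi a' := boxPlaqC1Small_pull U hS₀ hC
  have hshift := norm_axial_shift_sub_le (pull U) hP hC' ha ha' hn μ ν hz hz'
  -- the two bond variables lie in the half-ball of the chart
  have hWz : ‖((W z μ : SU N) : MatA N) - 1‖ ≤ 1 / 2 := by
    rw [← dist1_su_eq]; exact (dist1_axial_bond_le_uniform (pull U) hP ha hn z μ hz hzμ).trans hsmall
  have hWz' : ‖((W (z + e ν) μ : SU N) : MatA N) - 1‖ ≤ 1 / 2 := by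
    rw [← dist1_su_eq]; exact (dist1_axial_bond_le_uniform (pull U) hP ha hn (z + e ν) μ hzν hzνμ).trans hsmall
  have hlog := norm_logOnePlus_sub_logOnePlus_le hWz' hWz
  rw [sub_sub_sub_cancel_right] at hlog
  -- unfold the gradient of the potential
  unfold grad axialPotential
  dsimp only
  rw [hb, hb', coe_ιSU, coe_ιSU, ← smul_sub, norm_smul, norm_smul, norm_inv, norm_inv, Complex.norm_real, Complex.norm_mul, Complex.norm_I, one_mul,
    Complex.norm_real, Real.norm_of_nonneg hξ.le]
  rw [div_eq_mul_inv, mul_comm (4 * _) (ξ ^ 2)⁻¹, sq, mul_inv, mul_assoc]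
  refine mul_le_mul_of_nonneg_left (mul_le_mul_of_nonneg_left (hlog.trans ?_) (inv_nonneg.mpr hξ.le)) (inv_nonneg.mpr hξ.le)
  linarith

end Torus

end Literature.MathematicalPhysics.QuantumFieldTheory.Balaban1983to89.Node00

end
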